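import Literature.Analysis.UnboundedOperators.LinearizedBoltzmannCarlemanContinuity
import Literature.Analysis.UnboundedOperators.LinearizedBoltzmannGaussGrowth
import Literature.Analysis.UnboundedOperators.LinearizedBoltzmannFrequencyBounds
import HarnessLib

/-!
# Continuity of the kernel action and of the Chapman–Enskog representative in `ℝ³`

For a measurable `ψ` of Gaussian growth `|ψ(x)| ≤ C e^{|x|²/4}` on `ℝ³ = EuclideanSpace ℝ (Fin 3)` the
kernel action `(K ψ)(v) = ∫∫ ((v - v_*)·ω)₊ (ψ(v') + ψ(v_*') - ψ(v_*)) dω dM(v_*)` of the linearised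
hard-sphere operator is continuous (`continuous_kernelAction_of_gaussGrowth`): its first gain piece is
the Carleman gain (`integral_integral_gain_fst_eq_carlemanGain`, continuous by
`LinearizedBoltzmannCarlemanContinuity`), its second gain piece coincides with the first one in
dimension `3` (`integral_integral_gain_snd_eq_fst`, Bochner form of the exchange symmetry
`lintegral_lintegral_hardSphere_gain_exchange`), and its loss piece is continuous by dominated
convergence (`continuous_integral_integral_kernel_mul_of_gaussGrowth`). Consequently every
measurable `ψ` of Gaussian growth solving `ν ψ = K ψ - g` pointwise with `g` continuous is continuous
(`continuous_of_gaussGrowth_of_fixedPoint`). No new definitions are introduced.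
-/

open MeasureTheory Metric Real Set Filter Topology ProbabilityTheory Module
open scoped InnerProductSpace ENNReal

namespace Literature.Analysis.UnboundedOperators

noncomputable section

open Literature.MathematicalPhysics.KineticTheory (collide sphereMeasure hardSphereKernel carlemanKernel
  gradRadial carlemanKernel_nonneg gradRadial_nonneg carlemanGain linearBoltzmannGain linearBoltzmannGain_eq
  gainIntegrand linearBoltzmannGain_eq_carlemanGain lintegral_lintegral_hardSphere_gain_exchange
  norm_sq_collide_fst_add_norm_sq_collide_snd)
open Literature.Analysis.FluidPDE
open Literature.Analysis.FunctionSpaces (maxwellianBeta maxwellianBeta_one)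

section GeneralE

variable {E : Type*} [NormedAddCommGroup E] [InnerProductSpace ℝ E] [FiniteDimensional ℝ E]
  [MeasurableSpace E] [BorelSpace E]

/-- For a nonnegative measurable integrand the iterated Bochner integral `∫ (∫ B Φ dω) dM` is the
`toReal` of the iterated lower integral, as soon as the latter is finite. [folklore] -/
theorem integral_integral_kernel_eq_toReal {Φ : E × sphere (0 : E) 1 → ℝ} (hΦ : Measurable Φ)
    (hΦ0 : ∀ p, 0 ≤ Φ p) (v : E)
    (hfin : ∫⁻ w, ∫⁻ ω, ENNReal.ofReal (hardSphereKernel (v, w) ω * Φ (w, ω)) ∂sphereMeasure ∂stdGaussian E < ∞) :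
    ∫ w, ∫ ω, hardSphereKernel (v, w) ω * Φ (w, ω) ∂sphereMeasure ∂stdGaussian E =
      (∫⁻ w, ∫⁻ ω, ENNReal.ofReal (hardSphereKernel (v, w) ω * Φ (w, ω)) ∂sphereMeasure ∂stdGaussian E).toReal := by
  have hBm : Measurable fun p : E × sphere (0 : E) 1 => hardSphereKernel (v, p.1) p.2 := by
    have : Continuous fun p : E × sphere (0 : E) 1 => hardSphereKernel (v, p.1) p.2 := by
      unfold hardSphereKernel; fun_prop
    exact this.measurable
  have hF : Measurable fun p : E × sphere (0 : E) 1 => hardSphereKernel (v, p.1) p.2 * Φ p := hBm.mul hΦ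
  have hnn : ∀ w ω, 0 ≤ hardSphereKernel (v, w) ω * Φ (w, ω) := fun w ω =>
    mul_nonneg (le_max_right _ _) (hΦ0 _)
  have hinner : ∀ w, ∫ ω, hardSphereKernel (v, w) ω * Φ (w, ω) ∂sphereMeasure =
      (∫⁻ ω, ENNReal.ofReal (hardSphereKernel (v, w) ω * Φ (w, ω)) ∂sphereMeasure).toReal := fun w =>
    integral_eq_lintegral_of_nonneg_ae (Eventually.of_forall (hnn w))
      (hF.comp measurable_prodMk_left).aestronglyMeasurable
  simp_rw [hinner]
  have hL : Measurable fun w => ∫⁻ ω, ENNReal.ofReal (hardSphereKernel (v, w) ω * Φ (w, ω))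
      ∂(sphereMeasure : Measure (sphere (0 : E) 1)) := hF.ennreal_ofReal.lintegral_prod_right'
  exact integral_toReal hL.aemeasurable (ae_lt_top hL hfin.ne)

/-- The loss piece `v ↦ ∫ (∫ ((v - w)·ω)₊ dω) ψ(w) dM(w)` is continuous for `ψ` of Gaussian growth
(dominated convergence). [folklore] -/
theorem continuous_integral_integral_kernel_mul_of_gaussGrowth {ψ : E → ℝ} (hψ : Measurable ψ)
    {C : ℝ} (hC : ∀ x, |ψ x| ≤ C * Real.exp (‖x‖ ^ 2 / 4)) :
    Continuous fun v : E => ∫ w, ∫ ω, hardSphereKernel (v, w) ω * ψ w ∂sphereMeasure ∂stdGaussian E := by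
  haveI := isFiniteMeasure_sphereMeasure (E := E)
  have hC0 : 0 ≤ C := by
    have h := hC 0
    rw [norm_zero] at h
    norm_num at h
    exact (abs_nonneg _).trans h
  set S : ℝ := (sphereMeasure : Measure (sphere (0 : E) 1)).real univ with hS
  have hS0 : 0 ≤ S := measureReal_nonneg
  -- the inner integral is `s(v - w) ψ(w)`
  have hinner : ∀ v w, ∫ ω, hardSphereKernel (v, w) ω * ψ w ∂sphereMeasure =
      (∫ ω, hardSphereKernel (v, w) ω ∂sphereMeasure) * ψ w := fun v w => integral_mul_const _ _
  simp_rw [hinner]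
  refine continuous_iff_continuousAt.2 fun v₀ => ?_
  refine continuousAt_of_dominated (bound := fun w => S * (‖v₀‖ + 1 + ‖w‖) * (C * Real.exp (‖w‖ ^ 2 / 4)))
    ?_ ?_ ?_ ?_
  · exact Eventually.of_forall fun v =>
      ((continuous_sphereIntegral_hardSphereKernel.comp (Continuous.prodMk_right v)).measurable.mul
        hψ).aestronglyMeasurable
  · have hball : ∀ᶠ v in 𝓝 v₀, ‖v - v₀‖ < 1 := by
      have := Metric.ball_mem_nhds v₀ one_pos
      filter_upwards [this] with v hv
      rwa [mem_ball, dist_eq_norm] at hv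
    filter_upwards [hball] with v hv
    refine Eventually.of_forall fun w => ?_
    rw [Real.norm_eq_abs, abs_mul, abs_of_nonneg (sphereIntegral_hardSphereKernel_nonneg _)]
    refine mul_le_mul ((sphereIntegral_hardSphereKernel_le v w).trans ?_) (hC w) (abs_nonneg _)
      (by positivity)
    rw [← hS]
    refine mul_le_mul_of_nonneg_left ?_ hS0
    have : ‖v‖ ≤ ‖v₀‖ + 1 := by
      have := norm_le_insert' v v₀; linarith
    linarith
  · have h1 := integrable_one_add_norm_mul_exp_sq_div_four_stdGaussian (E := E)
    have h2 : Integrable (fun w : E => Real.exp (‖w‖ ^ 2 / 4)) (stdGaussian E) :=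
      h1.mono' (by fun_prop : Continuous fun w : E => Real.exp (‖w‖ ^ 2 / 4)).aestronglyMeasurable
        (Eventually.of_forall fun w => by
          rw [Real.norm_of_nonneg (Real.exp_nonneg _)]
          nlinarith [Real.exp_nonneg (‖w‖ ^ 2 / 4), norm_nonneg w])
    have : (fun w : E => S * (‖v₀‖ + 1 + ‖w‖) * (C * Real.exp (‖w‖ ^ 2 / 4))) =
        fun w => S * C * (‖v₀‖ * Real.exp (‖w‖ ^ 2 / 4)) +
          S * C * ((1 + ‖w‖) * Real.exp (‖w‖ ^ 2 / 4)) := by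
      funext w; ring
    rw [this]
    exact ((h2.const_mul _).const_mul _).add (h1.const_mul _)
  · exact Eventually.of_forall fun w =>
      ((continuous_sphereIntegral_hardSphereKernel.comp (Continuous.prodMk_left w)).continuousAt).mul
        continuousAt_const


end GeneralE

/-! ### The two gain pieces in `ℝ³`: Carleman form and exchange -/

/-- The first gain piece is the Carleman gain: `∫ (∫ B ψ(v') dω) dM = ∫ k(v, u) ψ(v + u) du` for `ψ`
of Gaussian growth (`linearBoltzmannGain_eq_carlemanGain` at `β = 1`). [folklore] -/
theorem integral_integral_gain_fst_eq_carlemanGain {ψ : EuclideanSpace ℝ (Fin 3) → ℝ}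
    (hψ : Measurable ψ) {C : ℝ} (hC : ∀ x, |ψ x| ≤ C * Real.exp (‖x‖ ^ 2 / 4))
    (v : EuclideanSpace ℝ (Fin 3)) :
    ∫ w, ∫ ω, hardSphereKernel (v, w) ω * ψ (collide ω (v, w)).1 ∂sphereMeasure
        ∂stdGaussian (EuclideanSpace ℝ (Fin 3)) = carlemanGain 1 ψ v := by
  rw [← linearBoltzmannGain_eq_carlemanGain (d := Fin 3) (by simp) one_pos hψ v
    (integrable_carlemanKernel_mul_of_gaussGrowth hψ hC v), linearBoltzmannGain_eq,
    integral_stdGaussian_eq_integral_mul_globalMaxwellian]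
  refine integral_congr_ae (Eventually.of_forall fun w => ?_)
  dsimp only
  rw [← integral_const_mul]
  refine integral_congr_ae (Eventually.of_forall fun ω => ?_)
  simp only [gainIntegrand, maxwellianBeta_one]
  ring

/-- **The second gain piece equals the first one in `ℝ³`** (Bochner form of the exchange symmetry
`lintegral_lintegral_hardSphere_gain_exchange`, for `ψ` of Gaussian growth):
`∫ (∫ B ψ(v_*') dω) dM(v_*) = ∫ (∫ B ψ(v') dω) dM(v_*)`. [folklore] -/
theorem integral_integral_gain_snd_eq_fst {ψ : EuclideanSpace ℝ (Fin 3) → ℝ}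
    (hψ : Measurable ψ) {C : ℝ} (hC : ∀ x, |ψ x| ≤ C * Real.exp (‖x‖ ^ 2 / 4))
    (v : EuclideanSpace ℝ (Fin 3)) :
    ∫ w, ∫ ω, hardSphereKernel (v, w) ω * ψ (collide ω (v, w)).2 ∂sphereMeasure
        ∂stdGaussian (EuclideanSpace ℝ (Fin 3)) =
      ∫ w, ∫ ω, hardSphereKernel (v, w) ω * ψ (collide ω (v, w)).1 ∂sphereMeasure
        ∂stdGaussian (EuclideanSpace ℝ (Fin 3)) := by
  have hC0 : 0 ≤ C := by
    have h := hC 0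
    rw [norm_zero] at h
    norm_num at h
    exact (abs_nonneg _).trans h
  -- positive and negative parts
  set ψp : EuclideanSpace ℝ (Fin 3) → ℝ := fun x => max (ψ x) 0 with hψp
  set ψm : EuclideanSpace ℝ (Fin 3) → ℝ := fun x => max (-ψ x) 0 with hψm
  have hψpm : Measurable ψp := hψ.max measurable_const
  have hψmm : Measurable ψm := hψ.neg.max measurable_const
  have hψp0 : ∀ x, 0 ≤ ψp x := fun x => le_max_right _ _
  have hψm0 : ∀ x, 0 ≤ ψm x := fun x => le_max_right _ _
  have hdec : ∀ x, ψ x = ψp x - ψm x := fun x => (max_zero_sub_max_neg_zero_eq_self (ψ x)).symm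
  have hCp : ∀ x, |ψp x| ≤ C * Real.exp (‖x‖ ^ 2 / 4) := fun x => by
    rw [abs_of_nonneg (hψp0 x)]
    exact max_le ((le_abs_self _).trans (hC x)) (by positivity)
  have hCm : ∀ x, |ψm x| ≤ C * Real.exp (‖x‖ ^ 2 / 4) := fun x => by
    rw [abs_of_nonneg (hψm0 x)]
    exact max_le ((neg_le_abs _).trans (hC x)) (by positivity)
  -- measurability of the collision maps
  have hc1 : Measurable fun p : EuclideanSpace ℝ (Fin 3) × sphere (0 : EuclideanSpace ℝ (Fin 3)) 1 =>
      (collide p.2 (v, p.1)).1 := by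
    have : Continuous fun p : EuclideanSpace ℝ (Fin 3) × sphere (0 : EuclideanSpace ℝ (Fin 3)) 1 =>
        (collide p.2 (v, p.1)).1 := by unfold collide; fun_prop
    exact this.measurable
  have hc2 : Measurable fun p : EuclideanSpace ℝ (Fin 3) × sphere (0 : EuclideanSpace ℝ (Fin 3)) 1 =>
      (collide p.2 (v, p.1)).2 := by
    have : Continuous fun p : EuclideanSpace ℝ (Fin 3) × sphere (0 : EuclideanSpace ℝ (Fin 3)) 1 =>
        (collide p.2 (v, p.1)).2 := by unfold collide; fun_prop
    exact this.measurable
  -- the nonnegative case through `lintegral`s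
  have key : ∀ {φ : EuclideanSpace ℝ (Fin 3) → ℝ}, Measurable φ → (∀ x, 0 ≤ φ x) →
      (∀ x, |φ x| ≤ C * Real.exp (‖x‖ ^ 2 / 4)) →
      ∫ w, ∫ ω, hardSphereKernel (v, w) ω * φ (collide ω (v, w)).2 ∂sphereMeasure
          ∂stdGaussian (EuclideanSpace ℝ (Fin 3)) =
        ∫ w, ∫ ω, hardSphereKernel (v, w) ω * φ (collide ω (v, w)).1 ∂sphereMeasure
          ∂stdGaussian (EuclideanSpace ℝ (Fin 3)) := by
    intro φ hφm hφ0 hφC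
    -- finiteness of the two lower integrals (Carleman bound)
    have hlin1 : ∫⁻ w, ∫⁻ ω, ENNReal.ofReal (hardSphereKernel (v, w) ω * φ (collide ω (v, w)).1)
        ∂sphereMeasure ∂stdGaussian (EuclideanSpace ℝ (Fin 3)) =
        ∫⁻ u, ENNReal.ofReal (carlemanKernel 1 v u) * ‖φ (v + u)‖ₑ := by
      have h := lintegral_stdGaussian_kernel_eq_volume (U := fun p => ‖φ (collide p.2 (v, p.1)).1‖ₑ)
        ((hφm.comp hc1).enorm) v
      rw [← lintegral_gain_fst_eq_carleman v hφm.enorm, ← h]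
      refine lintegral_congr fun w => lintegral_congr fun ω => ?_
      rw [ENNReal.ofReal_mul (show 0 ≤ hardSphereKernel (v, w) ω from le_max_right _ _),
        Real.enorm_eq_ofReal (hφ0 _)]
    have hlin2 : ∫⁻ w, ∫⁻ ω, ENNReal.ofReal (hardSphereKernel (v, w) ω * φ (collide ω (v, w)).2)
        ∂sphereMeasure ∂stdGaussian (EuclideanSpace ℝ (Fin 3)) =
        ∫⁻ u, ENNReal.ofReal (carlemanKernel 1 v u) * ‖φ (v + u)‖ₑ := by
      have h := lintegral_stdGaussian_kernel_eq_volume (U := fun p => ‖φ (collide p.2 (v, p.1)).2‖ₑ)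
        ((hφm.comp hc2).enorm) v
      rw [← lintegral_gain_fst_eq_carleman v hφm.enorm,
        ← lintegral_lintegral_hardSphere_gain_exchange v globalMaxwellian volume hφm.enorm, ← h]
      refine lintegral_congr fun w => lintegral_congr fun ω => ?_
      rw [ENNReal.ofReal_mul (show 0 ≤ hardSphereKernel (v, w) ω from le_max_right _ _),
        Real.enorm_eq_ofReal (hφ0 _)]
    have hfin : ∫⁻ u, ENNReal.ofReal (carlemanKernel 1 v u) * ‖φ (v + u)‖ₑ < ∞ := by
      have h := (integrable_carlemanKernel_mul_of_gaussGrowth hφm hφC v).2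
      rw [hasFiniteIntegral_iff_enorm] at h
      refine lt_of_le_of_lt (le_of_eq (lintegral_congr fun u => ?_)) h
      rw [enorm_mul, Real.enorm_eq_ofReal (carlemanKernel_nonneg 1 v u)]
    rw [integral_integral_kernel_eq_toReal (Φ := fun p => φ (collide p.2 (v, p.1)).2) (hφm.comp hc2)
        (fun _ => hφ0 _) v (by rw [hlin2]; exact hfin),
      integral_integral_kernel_eq_toReal (Φ := fun p => φ (collide p.2 (v, p.1)).1) (hφm.comp hc1)
        (fun _ => hφ0 _) v (by rw [hlin1]; exact hfin), hlin1, hlin2]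
  -- integrability of the four iterated integrals (Gaussian growth)
  have hB : Continuous fun p : EuclideanSpace ℝ (Fin 3) × sphere (0 : EuclideanSpace ℝ (Fin 3)) 1 =>
      hardSphereKernel (v, p.1) p.2 := by unfold hardSphereKernel; fun_prop
  have hbd : ∀ {φ : EuclideanSpace ℝ (Fin 3) → ℝ}, (∀ x, |φ x| ≤ C * Real.exp (‖x‖ ^ 2 / 4)) →
      ∀ (P : EuclideanSpace ℝ (Fin 3) × sphere (0 : EuclideanSpace ℝ (Fin 3)) 1 → EuclideanSpace ℝ (Fin 3)),
      (∀ w ω, ‖P (w, ω)‖ ^ 2 ≤ ‖v‖ ^ 2 + ‖w‖ ^ 2) →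
      ∀ w ω, |hardSphereKernel (v, w) ω * φ (P (w, ω))| ≤
        (C * ((1 + ‖v‖) * Real.exp (‖v‖ ^ 2 / 4))) * ((1 + ‖w‖) * Real.exp (‖w‖ ^ 2 / 4)) := by
    intro φ hφC P hP w ω
    have hB0 : 0 ≤ hardSphereKernel (v, w) ω := le_max_right _ _
    have hBle : hardSphereKernel (v, w) ω ≤ (1 + ‖v‖) * (1 + ‖w‖) := by
      refine (hardSphereKernel_le_abs_inner_add_norm v w ω).trans ?_
      nlinarith [abs_inner_sphere_le v ω, norm_nonneg v, norm_nonneg w,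
        mul_nonneg (norm_nonneg v) (norm_nonneg w)]
    have hexp : Real.exp (‖P (w, ω)‖ ^ 2 / 4) ≤ Real.exp (‖v‖ ^ 2 / 4) * Real.exp (‖w‖ ^ 2 / 4) := by
      rw [← Real.exp_add]; exact Real.exp_le_exp.2 (by linarith [hP w ω])
    rw [abs_mul, abs_of_nonneg hB0]
    calc hardSphereKernel (v, w) ω * |φ (P (w, ω))|
        ≤ ((1 + ‖v‖) * (1 + ‖w‖)) * (C * (Real.exp (‖v‖ ^ 2 / 4) * Real.exp (‖w‖ ^ 2 / 4))) :=
          mul_le_mul hBle ((hφC _).trans (mul_le_mul_of_nonneg_left hexp hC0)) (abs_nonneg _) (by positivity)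
      _ = _ := by ring
  have hP1 : ∀ w (ω : sphere (0 : EuclideanSpace ℝ (Fin 3)) 1), ‖(collide ω (v, w)).1‖ ^ 2 ≤ ‖v‖ ^ 2 + ‖w‖ ^ 2 :=
    fun w ω => by
      have h := Literature.MathematicalPhysics.KineticTheory.norm_sq_collide_fst_add_norm_sq_collide_snd ω (v, w)
      simp only at h; nlinarith [sq_nonneg ‖(collide ω (v, w)).2‖]
  have hP2 : ∀ w (ω : sphere (0 : EuclideanSpace ℝ (Fin 3)) 1), ‖(collide ω (v, w)).2‖ ^ 2 ≤ ‖v‖ ^ 2 + ‖w‖ ^ 2 :=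
    fun w ω => by
      have h := Literature.MathematicalPhysics.KineticTheory.norm_sq_collide_fst_add_norm_sq_collide_snd ω (v, w)
      simp only at h; nlinarith [sq_nonneg ‖(collide ω (v, w)).1‖]
  have hint : ∀ {φ : EuclideanSpace ℝ (Fin 3) → ℝ}, Measurable φ → (∀ x, |φ x| ≤ C * Real.exp (‖x‖ ^ 2 / 4)) →
      ∀ {P : EuclideanSpace ℝ (Fin 3) × sphere (0 : EuclideanSpace ℝ (Fin 3)) 1 → EuclideanSpace ℝ (Fin 3)},
      Measurable P → (∀ w ω, ‖P (w, ω)‖ ^ 2 ≤ ‖v‖ ^ 2 + ‖w‖ ^ 2) →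
      (∀ w, Integrable (fun ω => hardSphereKernel (v, w) ω * φ (P (w, ω)))
          (sphereMeasure : Measure (sphere (0 : EuclideanSpace ℝ (Fin 3)) 1))) ∧
        Integrable (fun w => ∫ ω, hardSphereKernel (v, w) ω * φ (P (w, ω)) ∂sphereMeasure)
          (stdGaussian (EuclideanSpace ℝ (Fin 3))) := by
    intro φ hφm hφC P hPm hP
    have hΦm : Measurable fun p : EuclideanSpace ℝ (Fin 3) × sphere (0 : EuclideanSpace ℝ (Fin 3)) 1 =>
        hardSphereKernel (v, p.1) p.2 * φ (P p) := hB.measurable.mul (hφm.comp hPm)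
    exact ⟨fun w => integrable_sphere_section_of_bound hΦm (fun w ω => hbd hφC P hP w ω) w,
      integrable_integral_sphere_of_gaussBound hΦm (fun w ω => hbd hφC P hP w ω)⟩
  obtain ⟨ip2, Ip2⟩ := hint hψpm hCp hc2 hP2
  obtain ⟨im2, Im2⟩ := hint hψmm hCm hc2 hP2
  obtain ⟨ip1, Ip1⟩ := hint hψpm hCp hc1 hP1
  obtain ⟨im1, Im1⟩ := hint hψmm hCm hc1 hP1
  -- linearity on both sides
  have hL : ∫ w, ∫ ω, hardSphereKernel (v, w) ω * ψ (collide ω (v, w)).2 ∂sphereMeasure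
      ∂stdGaussian (EuclideanSpace ℝ (Fin 3)) =
      (∫ w, ∫ ω, hardSphereKernel (v, w) ω * ψp (collide ω (v, w)).2 ∂sphereMeasure
        ∂stdGaussian (EuclideanSpace ℝ (Fin 3))) -
      ∫ w, ∫ ω, hardSphereKernel (v, w) ω * ψm (collide ω (v, w)).2 ∂sphereMeasure
        ∂stdGaussian (EuclideanSpace ℝ (Fin 3)) := by
    rw [← integral_sub Ip2 Im2]
    refine integral_congr_ae (Eventually.of_forall fun w => ?_)
    dsimp only
    rw [← integral_sub (ip2 w) (im2 w)]
    refine integral_congr_ae (Eventually.of_forall fun ω => ?_)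
    dsimp only
    rw [hdec]; ring
  have hR : ∫ w, ∫ ω, hardSphereKernel (v, w) ω * ψ (collide ω (v, w)).1 ∂sphereMeasure
      ∂stdGaussian (EuclideanSpace ℝ (Fin 3)) =
      (∫ w, ∫ ω, hardSphereKernel (v, w) ω * ψp (collide ω (v, w)).1 ∂sphereMeasure
        ∂stdGaussian (EuclideanSpace ℝ (Fin 3))) -
      ∫ w, ∫ ω, hardSphereKernel (v, w) ω * ψm (collide ω (v, w)).1 ∂sphereMeasure
        ∂stdGaussian (EuclideanSpace ℝ (Fin 3)) := by
    rw [← integral_sub Ip1 Im1]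
    refine integral_congr_ae (Eventually.of_forall fun w => ?_)
    dsimp only
    rw [← integral_sub (ip1 w) (im1 w)]
    refine integral_congr_ae (Eventually.of_forall fun ω => ?_)
    dsimp only
    rw [hdec]; ring
  rw [hL, hR, key hψpm hψp0 hCp, key hψmm hψm0 hCm]


/-! ### Continuity -/

/-- **The kernel action of a function of Gaussian growth is continuous on `ℝ³`**: its two gain pieces
are the Carleman gain (`integral_integral_gain_fst_eq_carlemanGain`, `integral_integral_gain_snd_eq_fst`,
continuous by `continuous_carlemanGain_of_gaussGrowth`) and its loss piece is continuous by
dominated convergence. [folklore] -/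
theorem continuous_kernelAction_of_gaussGrowth {ψ : EuclideanSpace ℝ (Fin 3) → ℝ} (hψ : Measurable ψ)
    {C : ℝ} (hC : ∀ x, |ψ x| ≤ C * Real.exp (‖x‖ ^ 2 / 4)) :
    Continuous fun v : EuclideanSpace ℝ (Fin 3) => ∫ w, ∫ ω, hardSphereKernel (v, w) ω *
      (ψ (collide ω (v, w)).1 + ψ (collide ω (v, w)).2 - ψ w) ∂sphereMeasure
        ∂stdGaussian (EuclideanSpace ℝ (Fin 3)) := by
  have h : (fun v : EuclideanSpace ℝ (Fin 3) => ∫ w, ∫ ω, hardSphereKernel (v, w) ω *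
      (ψ (collide ω (v, w)).1 + ψ (collide ω (v, w)).2 - ψ w) ∂sphereMeasure
        ∂stdGaussian (EuclideanSpace ℝ (Fin 3))) =
      fun v => 2 * carlemanGain 1 ψ v -
        ∫ w, ∫ ω, hardSphereKernel (v, w) ω * ψ w ∂sphereMeasure ∂stdGaussian (EuclideanSpace ℝ (Fin 3)) := by
    funext v
    rw [kernelAction_eq_pieces_of_gaussGrowth hψ hC v, integral_integral_gain_snd_eq_fst hψ hC v,
      integral_integral_gain_fst_eq_carlemanGain hψ hC v]
    ring
  rw [h]
  exact (continuous_const.mul (continuous_carlemanGain_of_gaussGrowth hψ hC)).sub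
    (continuous_integral_integral_kernel_mul_of_gaussGrowth hψ hC)

/-- **Continuity of the pointwise Chapman–Enskog inverse**: a measurable `ψ` of Gaussian growth on
`ℝ³` which solves `ν ψ = ∫∫ B (ψ' + ψ_*' - ψ_*) - g` pointwise with `g` continuous is continuous
(`ν` is continuous and positive, `collisionFrequency_pos_and_continuous`). [folklore] -/
theorem continuous_of_gaussGrowth_of_fixedPoint {ψ g : EuclideanSpace ℝ (Fin 3) → ℝ} (hψ : Measurable ψ)
    {C : ℝ} (hC : ∀ x, |ψ x| ≤ C * Real.exp (‖x‖ ^ 2 / 4)) (hg : Continuous g)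
    (hfix : ∀ v, collisionFrequency v * ψ v =
      (∫ w, ∫ ω, hardSphereKernel (v, w) ω * (ψ (collide ω (v, w)).1 + ψ (collide ω (v, w)).2 - ψ w)
        ∂sphereMeasure ∂stdGaussian (EuclideanSpace ℝ (Fin 3))) - g v) :
    Continuous ψ := by
  obtain ⟨hpos, hcont⟩ := collisionFrequency_pos_and_continuous (E := EuclideanSpace ℝ (Fin 3)) (by simp)
  have h : ψ = fun v => (collisionFrequency v)⁻¹ *
      ((∫ w, ∫ ω, hardSphereKernel (v, w) ω * (ψ (collide ω (v, w)).1 + ψ (collide ω (v, w)).2 - ψ w)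
        ∂sphereMeasure ∂stdGaussian (EuclideanSpace ℝ (Fin 3))) - g v) := by
    funext v
    rw [← hfix v, ← mul_assoc, inv_mul_cancel₀ (hpos v).ne', one_mul]
  rw [h]
  exact (hcont.inv₀ fun v => (hpos v).ne').mul ((continuous_kernelAction_of_gaussGrowth hψ hC).sub hg)


end

end Literature.Analysis.UnboundedOperators
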